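import Summits.ResolutionOfSingularities.ResolutionOfSingularities.Theorems.FrobeniusClosingPatchingRelPerfectDepthDictionaryStepPowHolds
import Summits.ResolutionOfSingularities.ResolutionOfSingularities.Theorems.FrobeniusClosingPatchingRelPerfectDepthTargetsWeightedDefs
import HarnessLib

/-!
# Crux `PatchingRelPerfect` (stmt-ResolutionOfSingularities-16161), chain W5.2 — rung R4 X-side:
# S-T, the SINGLETON TOWER — a format that survives one dictionary step survives every pure weight-`ℓ` sequence

[OURS · L1 W5.2 · rung tool] plan-1 g6 STEER (TargetsF2) 05:26:19Z (d) to res-L1-w52-stub-5 (= res-D-pv-016, author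
of D1 p495681 and D_ℓ p497259/p498608): «the X-side pure weight-`ℓ` tower driven by an E-side `IsPureWeightedSeq ℓ`
… iterate D_ℓ … ⊢ ∃ X′ π i′ K′, DepthInvariant ℓ at (E′, X′, K′) ∧ K′|_{E′} = 𝔟′ ∧ the model again». NOT a statement of
the manuscript under review; fact-free.

WHY A FORMAT. The depth-`ℓ` dictionary step D_ℓ (`DepthTargets.dictionaryStepPow_holds`) matches ONE E-side blowing up
along a regular centre `C` by one X-side blowing up along `Ĉ = C.map i`, PROVIDED the X-side permissibility `K ≤ Ĉ^ℓ`
holds — and for `ℓ ≥ 2` this is not decided by the E-side datum `K|_E` (res-L1-w52-tri-1 TRIAGE v6 (1)). What decides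
it is a MODEL of `K` near `E` (lead-1's graded/retraction format `DepthGraded.GradedFormat`, `…DepthGradedFormat.lean`:
`K|_V = r^*𝔟 ⊔ 𝓘_E^ℓ` for a retraction `r` of a neighbourhood `V` of `E`; its PERMISSIBILITY TRANSFER
`GradedFormat.le_map_pow` and its one-step PROPAGATION `…DepthGradedStep.lean`). This file is the format-GENERIC
iteration: for ANY predicate `P i K` on (closed immersion, residual ideal),

* `StepPow ℓ P` — one D_ℓ step at a state carrying `P`: E-side permissibility `K|_E ≤ C^ℓ` ⇒ X-side permissibility
  `K ≤ Ĉ^ℓ` (transfer) and the D_ℓ output `(X′, σ, i′, K′ = σᶜ(K, ℓ))` carries `P i′ K′` (propagation);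
* `TowerPow ℓ P` — every PURE WEIGHT-`ℓ` sequence `ρ : E′ → E` (`DepthTargets.IsPureWeightedSeq ℓ`, F2 p502025) from
  `K|_E` is matched by a pure weight-`ℓ` sequence `π : X′ → X` along the pushed centres with `i′ ≫ π = ρ ≫ i`,
  `DepthInvariant ℓ` at `(E′, X′, i′, π ≫ g, K′)`, `K′|_{E′} = 𝔟′` and `P i′ K′`;
* **`towerPow_of_stepPow : StepPow ℓ P → TowerPow ℓ P`** (induction on the E-side sequence; the new E-side ideal of a
  step is the controlled transform, `eq_controlledTransform_of_comap_eq`, by cancelling `(C𝒪)^ℓ`);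
* `stepPow_of_transfer_of_propagate` — TRANSFER + PROPAGATION ⇒ `StepPow ℓ P`, the step being D_ℓ by name;
* `stepPow_one_noFormat`, `towerPow_one_noFormat` — depth ONE needs no format (`K|_E ≤ C ⇒ K ≤ C.map i` is the Galois
  connection `comap ⊣ map`): the r-d1 X-side iteration, unconditionally.

The instance `P i K := DepthGraded.GradedFormat ℓ i K (K|_E)` (transfer = `GradedFormat.le_map_pow`, propagation =
lead-1's graded step) is closed by name in the companion file `…DepthSingletonTowerGraded.lean` once the graded step
lands; plan-1 types `SingletonTowerPow ℓ` over it (TargetsF4). AI-written; weaker than expert review.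

## References (method; the statements are ours)
* E. Bierstone, D. Grigoriev, P. Milman, J. Włodarczyk, *Effective Hironaka resolution and its complexity*, Asian J.
  Math. 15 (2011) = arXiv:1206.3090, Def. 3.1.3, §3.2 Lemma 3.2.1. [BierstoneGrigorievMilmanWlodarczyk2011]
* J. Kollár, *Lectures on Resolution of Singularities* (2007), 3.30.2, (3.111) Step 3. [Kollar2007]
* U. Görtz, T. Wedhorn, *Algebraic Geometry I*, 2nd ed. (2020), Prop. 13.91 (1), 13.96 (2). [GortzWedhorn2020]
-/

-- `Summit.<Summit>.<Sub>.Theorems` with `Sub = Summit` (single-conjunct summit, D-0017)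
set_option linter.dupNamespace false

noncomputable section

open CategoryTheory CategoryTheory.Limits AlgebraicGeometry TopologicalSpace
open Literature.AlgebraicGeometry.Resolution

namespace Summit.ResolutionOfSingularities.ResolutionOfSingularities.Theorems.DepthTargets

universe u

/-! ## §1 The formatted step and the formatted tower -/

/-- [OURS · L1 W5.2 · rung tool] **One dictionary step WITH A FORMAT `P`** (the shape a model of the residual ideal must have to drive
the tower): at a state of the depth-`ℓ` invariant carrying the format `P i K`, every blowing up `τ` of `E`
along a centre `C` with `V(C)` regular that is permissible ON THE E-SIDE (`K|_E ≤ C^ℓ`) is (1) permissible on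
the X-side, `K ≤ Ĉ^ℓ`, `Ĉ = C.map i` (PERMISSIBILITY TRANSFER), and (2) matched by a blowing up `σ` along
`Ĉ` re-establishing the invariant with `K' = σᶜ(K, ℓ)`, `K'|_{E'} = τᶜ(K|_E, ℓ)` (D_ℓ `DictionaryStepPow`)
AND the format `P i' K'` (PROPAGATION). [cite: BierstoneGrigorievMilmanWlodarczyk2011, §3.2 Lemma 3.2.1]
[cite: GortzWedhorn2020, Prop. 13.91 (1), Prop. 13.96 (2)] -/
def StepPow (ℓ : ℕ) (P : ∀ ⦃E X : Scheme.{u}⦄, (E ⟶ X) → X.IdealSheafData → Prop) : Prop :=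
  ∀ (S : Type u) [CommRing S] [IsRegularLocalRing S] (I : Ideal S)
    (E X : Scheme.{u}) (i : E ⟶ X) (g : X ⟶ Spec (.of S)) (K : X.IdealSheafData),
    DepthInvariant ℓ S I E X i g K → P i K →
    ∀ (E' : Scheme.{u}) (τ : E' ⟶ E) (C : E.IdealSheafData),
      Scheme.IsRegular C.subscheme → K.comap i ≤ C ^ ℓ → IsBlowup τ C →
        K ≤ C.map i ^ ℓ ∧
        ∃ (X' : Scheme.{u}) (σ : X' ⟶ X) (i' : E' ⟶ X'),
          IsBlowup σ (C.map i) ∧ i' ≫ σ = τ ≫ i ∧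
          DepthInvariant ℓ S I E' X' i' (σ ≫ g) (controlledTransform σ (C.map i) K ℓ) ∧
          (controlledTransform σ (C.map i) K ℓ).comap i' = controlledTransform τ C (K.comap i) ℓ ∧
          P i' (controlledTransform σ (C.map i) K ℓ)

/-- [OURS · L1 W5.2 · rung tool] **The tower WITH A FORMAT `P`**: at a state of the depth-`ℓ` invariant carrying `P i K`, every PURE
WEIGHT-`ℓ` sequence `ρ : E' → E` of the exceptional threefold starting from the E-side datum `K|_E` is matched
by a pure weight-`ℓ` sequence `π : X' → X` of the ambient scheme along the pushed centres, with `E'` the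
iterated strict transform (`i' ≫ π = ρ ≫ i`), the invariant at `(E', X', i', π ≫ g, K')`, `K'|_{E'} = 𝔟'`
the end of the E-side sequence, and the format `P i' K'` again. [cite: Kollar2007, 3.30.2, (3.111) Step 3]
[cite: BierstoneGrigorievMilmanWlodarczyk2011, Def. 3.1.3, §3.2] -/
def TowerPow (ℓ : ℕ) (P : ∀ ⦃E X : Scheme.{u}⦄, (E ⟶ X) → X.IdealSheafData → Prop) : Prop :=
  ∀ (S : Type u) [CommRing S] [IsRegularLocalRing S] (I : Ideal S)
    (E X : Scheme.{u}) (i : E ⟶ X) (g : X ⟶ Spec (.of S)) (K : X.IdealSheafData),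
    DepthInvariant ℓ S I E X i g K → P i K →
    ∀ (E' : Scheme.{u}) (ρ : E' ⟶ E) (𝔟' : E'.IdealSheafData),
      IsPureWeightedSeq ℓ ρ (K.comap i) 𝔟' →
        ∃ (X' : Scheme.{u}) (π : X' ⟶ X) (i' : E' ⟶ X') (K' : X'.IdealSheafData),
          IsPureWeightedSeq ℓ π K K' ∧ i' ≫ π = ρ ≫ i ∧
          DepthInvariant ℓ S I E' X' i' (π ≫ g) K' ∧ K'.comap i' = 𝔟' ∧ P i' K'

/-- The last ideal of a pure weighted step is the controlled transform: from `𝔟' 𝒪 = (C𝒪)^μ · 𝔟''` and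
`𝔟' ≤ C^μ`, `𝔟'' = τᶜ(𝔟', μ)` (cancel the effective Cartier divisor `(C𝒪)^μ`).
[cite: BierstoneGrigorievMilmanWlodarczyk2011, §3.2 Lemma 3.2.1] -/
theorem eq_controlledTransform_of_comap_eq {E'' E' : Scheme.{u}} {τ : E'' ⟶ E'} {C 𝔟' : E'.IdealSheafData}
    {𝔟'' : E''.IdealSheafData} {μ : ℕ} (hτ : IsBlowup τ C) (hle : 𝔟' ≤ C ^ μ)
    (heq : 𝔟'.comap τ = C.comap τ ^ μ * 𝔟'') : 𝔟'' = controlledTransform τ C 𝔟' μ := by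
  apply (hτ.isEffectiveCartier.pow μ).eq_of_mul_eq_mul
  rw [← heq, hτ.pow_mul_controlledTransform_eq]
  have h : 𝔟'.comap τ ≤ (C ^ μ).comap τ := Scheme.IdealSheafData.comap_mono (f := τ) hle
  rwa [comap_pow] at h

/-- [OURS · L1 W5.2 · rung tool] **S-T, the SINGLETON TOWER: a format that survives one step survives every pure weight-`ℓ` sequence.**
Induction on the E-side sequence: the empty sequence is matched by the empty sequence; a sequence
`τ ≫ ρ` is matched by first matching `ρ` (induction) and then running the formatted step at the top, the
E-side permissibility `𝔟' ≤ C^ℓ` being read through `K'|_{E'} = 𝔟'`; the new E-side ideal is identified with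
`τᶜ(𝔟', ℓ)` by cancelling `(C𝒪)^ℓ`, and the X-side step is recorded as a pure weight-`ℓ` step along
`Ĉ = C.map i'` (`σ^*K' = 𝓘_{exc}^ℓ · σᶜ(K', ℓ)`, BGMW Lemma 3.2.1).
[cite: BierstoneGrigorievMilmanWlodarczyk2011, §3.2 Lemma 3.2.1, Def. 3.1.3] [cite: Kollar2007, (3.111) Step 3] -/
theorem towerPow_of_stepPow {ℓ : ℕ} {P : ∀ ⦃E X : Scheme.{u}⦄, (E ⟶ X) → X.IdealSheafData → Prop}
    (hstep : StepPow ℓ P) : TowerPow ℓ P := by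
  -- the induction, with the starting E-side ideal generalized to a variable `𝔟`
  have key : ∀ {E' E : Scheme.{u}} {ρ : E' ⟶ E} {𝔟 : E.IdealSheafData} {𝔟' : E'.IdealSheafData},
      IsPureWeightedSeq ℓ ρ 𝔟 𝔟' →
      ∀ (S : Type u) [CommRing S] [IsRegularLocalRing S] (I : Ideal S) (X : Scheme.{u}) (i : E ⟶ X)
        (g : X ⟶ Spec (.of S)) (K : X.IdealSheafData),
        DepthInvariant ℓ S I E X i g K → P i K → K.comap i = 𝔟 →
        ∃ (X' : Scheme.{u}) (π : X' ⟶ X) (i' : E' ⟶ X') (K' : X'.IdealSheafData),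
          IsPureWeightedSeq ℓ π K K' ∧ i' ≫ π = ρ ≫ i ∧
          DepthInvariant ℓ S I E' X' i' (π ≫ g) K' ∧ K'.comap i' = 𝔟' ∧ P i' K' := by
    intro E' E ρ 𝔟 𝔟' hseq
    induction hseq with
    | nil 𝔟 =>
      intro S _ _ I X i g K hinv hP h𝔟
      exact ⟨X, 𝟙 X, i, K, .nil K, by simp, by simpa using hinv, h𝔟, hP⟩
    | cons τ ρ 𝔟 𝔟₁ 𝔟₂ C hρ hC hle hτ heq ih =>
      intro S _ _ I X i g K hinv hP h𝔟
      obtain ⟨X₁, π, i₁, K₁, hXseq, hsq, hinv₁, hK₁, hP₁⟩ := ih S I X i g K hinv hP h𝔟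
      have hle' : K₁.comap i₁ ≤ C ^ ℓ := hK₁ ▸ hle
      obtain ⟨hperm, X₂, σ, i₂, hσ, hsq₂, hinv₂, hK₂, hP₂⟩ :=
        hstep S I _ X₁ i₁ (π ≫ g) K₁ hinv₁ hP₁ _ τ C hC hle' hτ
      haveI := hinv₁.isClosedImmersion
      refine ⟨X₂, σ ≫ π, i₂, controlledTransform σ (C.map i₁) K₁ ℓ, ?_, ?_, ?_, ?_, hP₂⟩
      · -- the X-side step is a pure weight-`ℓ` step along `C.map i₁`
        refine .cons σ π K K₁ _ (C.map i₁) hXseq (DepthOne.isRegular_subscheme_map i₁ C hC) hperm hσ ?_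
        refine (hσ.pow_mul_controlledTransform_eq ?_).symm
        have h : K₁.comap σ ≤ ((C.map i₁) ^ ℓ).comap σ :=
          Scheme.IdealSheafData.comap_mono (f := σ) hperm
        rwa [comap_pow] at h
      · rw [Category.assoc, ← hsq, ← Category.assoc, hsq₂, Category.assoc]
      · rw [Category.assoc]; exact hinv₂
      · rw [hK₂, hK₁]; exact (eq_controlledTransform_of_comap_eq hτ hle heq).symm
  intro S _ _ I E X i g K hinv hP E' ρ 𝔟' hseq
  exact key hseq S I X i g K hinv hP rfl

/-! ## §2 Building a formatted step from a transfer and a propagation -/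

/-- **How to build a formatted step**: a PERMISSIBILITY TRANSFER for `P` (`K|_E ≤ C^ℓ ⇒ K ≤ Ĉ^ℓ` at every
state carrying `P`) and a PROPAGATION of `P` through the output of the depth-`ℓ` dictionary step give
`StepPow ℓ P`, the step itself being `dictionaryStepPow_holds ℓ` (D_ℓ, p498608).
[cite: GortzWedhorn2020, Prop. 13.91 (1), Prop. 13.96 (2)] [cite: BierstoneGrigorievMilmanWlodarczyk2011, §3.2 Lemma 3.2.1] -/
theorem stepPow_of_transfer_of_propagate {ℓ : ℕ}
    {P : ∀ ⦃E X : Scheme.{u}⦄, (E ⟶ X) → X.IdealSheafData → Prop}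
    (htransfer : ∀ (S : Type u) [CommRing S] [IsRegularLocalRing S] (I : Ideal S)
      (E X : Scheme.{u}) (i : E ⟶ X) (g : X ⟶ Spec (.of S)) (K : X.IdealSheafData),
      DepthInvariant ℓ S I E X i g K → P i K →
      ∀ C : E.IdealSheafData, Scheme.IsRegular C.subscheme → K.comap i ≤ C ^ ℓ → K ≤ C.map i ^ ℓ)
    (hpropagate : ∀ (S : Type u) [CommRing S] [IsRegularLocalRing S] (I : Ideal S)
      (E X : Scheme.{u}) (i : E ⟶ X) (g : X ⟶ Spec (.of S)) (K : X.IdealSheafData),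
      DepthInvariant ℓ S I E X i g K → P i K →
      ∀ (E' : Scheme.{u}) (τ : E' ⟶ E) (C : E.IdealSheafData),
        Scheme.IsRegular C.subscheme → K.comap i ≤ C ^ ℓ → IsBlowup τ C →
        ∀ (X' : Scheme.{u}) (σ : X' ⟶ X) (i' : E' ⟶ X'), IsBlowup σ (C.map i) → i' ≫ σ = τ ≫ i →
          DepthInvariant ℓ S I E' X' i' (σ ≫ g) (controlledTransform σ (C.map i) K ℓ) →
          (controlledTransform σ (C.map i) K ℓ).comap i' = controlledTransform τ C (K.comap i) ℓ →
          P i' (controlledTransform σ (C.map i) K ℓ)) :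
    StepPow ℓ P := by
  intro S _ _ I E X i g K hinv hP E' τ C hC hle hτ
  have hperm : K ≤ C.map i ^ ℓ := htransfer S I E X i g K hinv hP C hC hle
  obtain ⟨X', σ, i', hσ, hsq, hinv', hK'⟩ := dictionaryStepPow_holds ℓ S I E X i g K hinv E' τ C hC hperm hτ
  exact ⟨hperm, X', σ, i', hσ, hsq, hinv', hK',
    hpropagate S I E X i g K hinv hP E' τ C hC hle hτ X' σ i' hσ hsq hinv' hK'⟩

/-! ## §3 Depth one: no format is needed -/

/-- [OURS · L1 W5.2 · rung tool] **No format** (the trivial predicate, for depth one). -/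
def NoFormat : ∀ ⦃E X : Scheme.{u}⦄, (E ⟶ X) → X.IdealSheafData → Prop := fun _ _ _ _ => True

/-- **Depth one needs no format**: for `ℓ = 1` the E-side permissibility `K|_E ≤ C` already gives
`K ≤ C.map i` (the Galois connection `comap ⊣ map` of ideal sheaves), so `StepPow 1 NoFormat` holds by D_1
alone (this is r-d1's dictionary step D1, p495681, iterated below). [cite: GortzWedhorn2020, Prop. 13.91 (1), Prop. 13.96 (2)] -/
theorem stepPow_one_noFormat : StepPow 1 NoFormat.{u} := by
  refine stepPow_of_transfer_of_propagate ?_ (fun _ _ _ _ _ _ _ _ _ _ _ _ _ _ _ _ _ _ _ _ _ _ _ _ => trivial)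
  intro S _ _ I E X i g K _ _ C _ hle
  rw [pow_one] at hle ⊢
  exact Scheme.IdealSheafData.le_map_iff_comap_le.mpr hle

/-- **The depth-one tower, format-free**: every pure weight-one (= controlled, BGMW Def. 3.1.3) sequence of
the exceptional threefold starting from `K|_E` lifts to the ambient scheme preserving `DepthInvariant 1`.
[cite: BierstoneGrigorievMilmanWlodarczyk2011, Def. 3.1.3, §3.2] [cite: Kollar2007, (3.111) Step 3] -/
theorem towerPow_one_noFormat : TowerPow 1 NoFormat.{u} :=
  towerPow_of_stepPow stepPow_one_noFormat

end Summit.ResolutionOfSingularities.ResolutionOfSingularities.Theorems.DepthTargets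

end
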